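import Summits.CriticalPhenomena.PercolationContinuityZ3.Theorems.PercNearOneGluingNoHeavyQuantGatedConvSplit
import Summits.CriticalPhenomena.PercolationContinuityZ3.Theorems.PercNearOneGluingNoHeavyQuantDECAtTarget
import HarnessLib

/-!
# QUANT lane R8, T-DEC, leg (III): the AFFINE FAMILY of gated-convolution splits at an arbitrary pinning level `p`, and its tree reading —
# the BINARY TREE SURGERY identity `gate_q(gate_{q₁}A ∗ gate_{q₂}B) = α·(split the root) + β·(merge the root with its larger-gate child)`

builds on p205010 (kernel theorem, internal audit signed; external expert review pending)

Support file (`--supports stmt-CriticalPhenomena-4575`), QUANT lane lead (gen 27), rung R8 of `run/shared/lean/prim/quant/LADDER.md`; memo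
`run/shared/lean/prim/quant/prim-quant-lead-g27/LEAD-NOTES-G27.md` N75 (README V293).  Theorems only, standard axioms, no sorries, no definitions.
Continues typer g25's `…QuantGatedConvSplit` (`gate_lconv_split` = the endpoint `p = μ₁ 0` of the family below; `posPart`, `coPart`).

THE FAMILY.  For laws `μ₁`, `μ₂` on `{0..M₁}`, `{0..M₂}`, a gate `q` and ANY level `p` (`p ≠ 1`, `1 − q + qp ≠ 0`), writing `μ^{(p)} := (μ − pδ₀)/(1−p)`
(`= coPart (fun _ ↦ p) μ` — a probability law iff `p ≤ μ 0`; `μ^{(μ 0)} = posPart μ`):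
    `gate_q(μ₁ ∗ μ₂) = p/(1−q+qp) · (gate_q μ₁ ∗ gate_q μ₂) + (1−q)(1−p)/(1−q+qp) · gate_{q(1−p)}(μ₁^{(p)} ∗ μ₂^{(p)})`   (`gate_lconv_split_at`).
At `p = μ₁ 0` one factor becomes empty-free (the lane's reduction to `GatedConvEmptyFree`).  At `p = 1 − q₁` for GATED factors `μᵢ = gate_{qᵢ} Aᵢ` with
`q₂ ≤ q₁` the reduced laws are `A₁` and `gate_{q₂/q₁} A₂` (`coPart_const_gate`), giving the TREE SURGERY (`gate_lconv_gate_gate`):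
    `gate_q(gate_{q₁}A₁ ∗ gate_{q₂}A₂) = (1−q₁)/(1−qq₁)·(gate_{qq₁}A₁ ∗ gate_{qq₂}A₂) + q₁(1−q)/(1−qq₁)·gate_{qq₁}(A₁ ∗ gate_{q₂/q₁}A₂)`
— at a binary branch point `v(q) → {c₁(q₁), c₂(q₂)}` of a tree, the reached-relay count law is a mixture of the law of the FOREST obtained by splitting `v` into
two independent copies and of the law of the TREE obtained by merging `v` with `c₁` (gate `qq₁`) and re-hanging `c₂` below it with gate `q₂/q₁`: same relays,
same marginals, same mean, one vertex fewer.  Since DEC at a fixed target is convex (`decAtT_mixture`), `decAtT_gate_lconv_of_split_at` turns any member of the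
family into a sufficient pair of conditions; with `A₁ = δ_a` it is the lead's `…QuantGateSliceDominated`.  HONEST STATUS (README V293): the surgery is EXACT at
binary branch points but there is NO convex surgery at degree ≥ 3 (the reached-gate table of `v(q) → {c₁,c₂,c₃}` is not in the hull of smaller structures), so
`GatedConvEmptyFree` / `GateMove` / `SDECConvClosed` remain the law-level statements of leg (III); this file is a tool, all of them stay OPEN.

* `LawDec.coPart_const_apply`, `coPart_const_self` (`coPart (fun _ ↦ μ 0) μ = posPart μ`), `coPart_const_gate` (`(gate A q₁)^{(1−q₁)} = A`),
  `coPart_const_gate_gate` (`(gate B q₂)^{(1−q₁)} = gate B (q₂/q₁)`), `coPart_const_laws` (probability law with mean `T/(1−p)` when `p ≤ μ 0`).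
* **`LawDec.gate_lconv_split_at`** — the family; **`LawDec.gate_lconv_gate_gate`** — the tree surgery; **`LawDec.decAtT_gate_lconv_of_split_at`**,
  `LawDec.decAtT_gate_lconv_gate_gate` — the DEC corollaries.

[this work]; `gate_lconv_split`: typer g25; SDEC / the closure conjecture: census-2 g53 (this lane).  Nothing here is cited as a published result.
The gluing rows served [cite: KozmaNitzan2024, Conjecture 3 (p. 15)]; product measure [cite: Grimmett1999, §1.3 p. 10].
-/

noncomputable section

namespace Summit.CriticalPhenomena.PercolationContinuityZ3.Theorems

namespace Quant

open Finset

namespace LawDec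

/-! ### The reduced law `μ^{(p)} = coPart (fun _ ↦ p) μ` -/

/-- pointwise form of the reduced law `μ^{(p)} = (μ − pδ₀)/(1−p)`. [this work] -/
theorem coPart_const_apply (p : ℝ) (μ : ℕ → ℝ) (h : ℕ) :
    coPart (fun _ => p) μ h = (μ h - (if h = 0 then p else 0)) / (1 - p) := by
  simp only [coPart]
  split_ifs with h0
  · subst h0; ring
  · ring

/-- at `p = μ 0` the reduced law is the empty-free part. [this work] -/
theorem coPart_const_self (μ : ℕ → ℝ) : coPart (fun _ => μ 0) μ = posPart μ := by
  funext h
  simp only [coPart, posPart]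
  split_ifs with h0
  · subst h0; simp
  · rfl

/-- **de-gating**: the reduction at level `1 − q₁` of a law gated by `q₁ ≠ 0` is the un-gated law. [this work] -/
theorem coPart_const_gate (A : ℕ → ℝ) (q₁ : ℝ) (hq : q₁ ≠ 0) : coPart (fun _ => 1 - q₁) (gate A q₁) = A := by
  funext h
  rw [coPart_const_apply, gate_apply, sub_sub_cancel]
  by_cases h0 : h = 0
  · subst h0; simp only [if_true]; field_simp; ring
  · simp only [if_neg h0]; field_simp; ring

/-- **re-hanging**: the reduction at level `1 − q₁` of a law gated by `q₂` is the law gated by `q₂/q₁` (`q₁ ≠ 0`). [this work] -/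
theorem coPart_const_gate_gate (B : ℕ → ℝ) (q₁ q₂ : ℝ) (hq : q₁ ≠ 0) :
    coPart (fun _ => 1 - q₁) (gate B q₂) = gate B (q₂ / q₁) := by
  funext h
  rw [coPart_const_apply, gate_apply, gate_apply, sub_sub_cancel]
  by_cases h0 : h = 0
  · subst h0; simp only [if_true]; field_simp; ring
  · simp only [if_neg h0]; field_simp; ring

/-- law facts of the reduced law (`p ≤ μ 0`, `p < 1`): nonnegative, vanishing above `M`, mass `1`, mean `T/(1−p)` (typer g25's `coPart_laws` with a
constant first argument). [this work] -/
theorem coPart_const_laws (M : ℕ) (p : ℝ) (μ : ℕ → ℝ) (hμ0 : ∀ h, 0 ≤ μ h) (hμM : ∀ h, M < h → μ h = 0)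
    (hμ1 : ∑ h ∈ Finset.range (M + 1), μ h = 1) (hp : p < 1) (hle : p ≤ μ 0) :
    (∀ h, 0 ≤ coPart (fun _ => p) μ h) ∧ (∀ h, M < h → coPart (fun _ => p) μ h = 0) ∧
      (∑ h ∈ Finset.range (M + 1), coPart (fun _ => p) μ h = 1) ∧
      (∑ h ∈ Finset.range (M + 1), (h : ℝ) * coPart (fun _ => p) μ h = (∑ h ∈ Finset.range (M + 1), (h : ℝ) * μ h) / (1 - p)) :=
  coPart_laws M (fun _ => p) μ hμ0 hμM hμ1 hp hle

/-! ### The affine family of splits -/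

/-- **THE SPLIT AT LEVEL `p`**: for laws on `{0..M₁}`, `{0..M₂}`, `p ≠ 1`, `1 − q + qp ≠ 0`:
`gate_q(μ₁ ∗ μ₂) = p/(1−q+qp)·(gate_q μ₁ ∗ gate_q μ₂) + (1−q)(1−p)/(1−q+qp)·gate_{q(1−p)}(μ₁^{(p)} ∗ μ₂^{(p)})` — pure algebra (`μᵢ = pδ₀ + (1−p)μᵢ^{(p)}`,
bilinearity of `lconv`, `gate` affine); typer g25's `gate_lconv_split` is `p = μ₁ 0`. [this work] -/
theorem gate_lconv_split_at (M₁ M₂ : ℕ) (μ₁ μ₂ : ℕ → ℝ) (q p : ℝ) (h1M : ∀ h, M₁ < h → μ₁ h = 0) (h2M : ∀ h, M₂ < h → μ₂ h = 0)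
    (hp : p ≠ 1) (ha : 1 - q + q * p ≠ 0) (h : ℕ) :
    gate (lconv M₁ M₂ μ₁ μ₂) q h =
      (p / (1 - q + q * p)) * lconv M₁ M₂ (gate μ₁ q) (gate μ₂ q) h +
      ((1 - q) * (1 - p) / (1 - q + q * p)) *
        gate (lconv M₁ M₂ (coPart (fun _ => p) μ₁) (coPart (fun _ => p) μ₂)) (q * (1 - p)) h := by
  have h1p : 1 - p ≠ 0 := sub_ne_zero.2 (Ne.symm hp)
  set ν₁ : ℕ → ℝ := coPart (fun _ => p) μ₁ with hν₁
  set ν₂ : ℕ → ℝ := coPart (fun _ => p) μ₂ with hν₂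
  -- the two factors as affine combinations of `δ₀` and the reduced laws
  have e1 : μ₁ = fun i => p * (if i = 0 then (1 : ℝ) else 0) + (1 - p) * ν₁ i := by
    funext i
    rw [hν₁, coPart_const_apply]
    by_cases hi : i = 0
    · subst hi; simp only [if_true]; field_simp; ring
    · simp only [if_neg hi, mul_zero, zero_add, sub_zero]; field_simp
  have e2 : μ₂ = fun k => p * (if k = 0 then (1 : ℝ) else 0) + (1 - p) * ν₂ k := by
    funext k
    rw [hν₂, coPart_const_apply]
    by_cases hk : k = 0
    · subst hk; simp only [if_true]; field_simp; ring
    · simp only [if_neg hk, mul_zero, zero_add, sub_zero]; field_simp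
  have g1 : gate μ₁ q = fun i => (1 - q + q * p) * (if i = 0 then (1 : ℝ) else 0) + (q * (1 - p)) * ν₁ i := by
    funext i; rw [gate_apply]; conv_lhs => rw [e1]
    simp only; ring
  have g2 : gate μ₂ q = fun k => (1 - q + q * p) * (if k = 0 then (1 : ℝ) else 0) + (q * (1 - p)) * ν₂ k := by
    funext k; rw [gate_apply]; conv_lhs => rw [e2]
    simp only; ring
  -- vanishing above the tops
  have hδM₂ : ∀ t, M₂ < t → (fun s : ℕ => if s = 0 then (1 : ℝ) else 0) t = 0 := fun t ht => by
    simp only; rw [if_neg (by omega)]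
  have h1M' : ∀ t, M₁ < t → ν₁ t = 0 := fun t ht => by
    rw [hν₁, coPart_const_apply, if_neg (by omega), h1M t ht, sub_zero, zero_div]
  have h2M' : ∀ t, M₂ < t → ν₂ t = 0 := fun t ht => by
    rw [hν₂, coPart_const_apply, if_neg (by omega), h2M t ht, sub_zero, zero_div]
  have cδδ := lconv_delta_left M₁ M₂ (fun s : ℕ => if s = 0 then (1 : ℝ) else 0) hδM₂ h
  have cδ2 := lconv_delta_left M₁ M₂ ν₂ h2M' h
  have c1δ := lconv_delta_right M₁ M₂ ν₁ h1M' h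
  have expand : ∀ α β : ℝ,
      lconv M₁ M₂ (fun i => α * (if i = 0 then (1 : ℝ) else 0) + β * ν₁ i)
        (fun k => α * (if k = 0 then (1 : ℝ) else 0) + β * ν₂ k) h
      = α * α * (if h = 0 then (1 : ℝ) else 0) + α * β * ν₂ h + β * α * ν₁ h + β * β * lconv M₁ M₂ ν₁ ν₂ h := by
    intro α β
    rw [lconv_lin_left, lconv_lin_right, lconv_lin_right, cδδ, cδ2, c1δ]
    ring
  have L : gate (lconv M₁ M₂ μ₁ μ₂) q h = q * (p * p * (if h = 0 then (1 : ℝ) else 0)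
      + p * (1 - p) * ν₂ h + (1 - p) * p * ν₁ h + (1 - p) * (1 - p) * lconv M₁ M₂ ν₁ ν₂ h)
      + (1 - q) * (if h = 0 then (1 : ℝ) else 0) := by
    rw [gate_apply]
    conv_lhs => rw [e1, e2]
    rw [expand]
  have A : lconv M₁ M₂ (gate μ₁ q) (gate μ₂ q) h
      = (1 - q + q * p) * (1 - q + q * p) * (if h = 0 then (1 : ℝ) else 0)
      + (1 - q + q * p) * (q * (1 - p)) * ν₂ h + (q * (1 - p)) * (1 - q + q * p) * ν₁ h
      + (q * (1 - p)) * (q * (1 - p)) * lconv M₁ M₂ ν₁ ν₂ h := by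
    rw [g1, g2, expand]
  have B : gate (lconv M₁ M₂ ν₁ ν₂) (q * (1 - p)) h
      = q * (1 - p) * lconv M₁ M₂ ν₁ ν₂ h + (1 - q * (1 - p)) * (if h = 0 then (1 : ℝ) else 0) := by
    rw [gate_apply]
  rw [L, A, B]
  field_simp
  ring

/-- **THE BINARY TREE SURGERY** (level `p = 1 − q₁`): for laws `A₁`, `A₂` on `{0..M₁}`, `{0..M₂}` and gates `q₁ ≠ 0`, `qq₁ ≠ 1`:
`gate_q(gate_{q₁}A₁ ∗ gate_{q₂}A₂) = (1−q₁)/(1−qq₁)·(gate_q gate_{q₁}A₁ ∗ gate_q gate_{q₂}A₂) + q₁(1−q)/(1−qq₁)·gate_{qq₁}(A₁ ∗ gate_{q₂/q₁}A₂)` —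
split the root into two independent copies / merge the root with the child `c₁` and re-hang `c₂` below it (legitimate as a tree when `q₂ ≤ q₁`).
[this work] -/
theorem gate_lconv_gate_gate (M₁ M₂ : ℕ) (A₁ A₂ : ℕ → ℝ) (q q₁ q₂ : ℝ) (h1M : ∀ h, M₁ < h → A₁ h = 0) (h2M : ∀ h, M₂ < h → A₂ h = 0)
    (hq₁ : q₁ ≠ 0) (hqq : q * q₁ ≠ 1) (h : ℕ) :
    gate (lconv M₁ M₂ (gate A₁ q₁) (gate A₂ q₂)) q h =
      ((1 - q₁) / (1 - q * q₁)) * lconv M₁ M₂ (gate (gate A₁ q₁) q) (gate (gate A₂ q₂) q) h +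
      (q₁ * (1 - q) / (1 - q * q₁)) * gate (lconv M₁ M₂ A₁ (gate A₂ (q₂ / q₁))) (q * q₁) h := by
  have g1M : ∀ t, M₁ < t → gate A₁ q₁ t = 0 := fun t ht => by
    rw [gate_apply, h1M t ht, if_neg (by omega)]; ring
  have g2M : ∀ t, M₂ < t → gate A₂ q₂ t = 0 := fun t ht => by
    rw [gate_apply, h2M t ht, if_neg (by omega)]; ring
  have hp : (1 - q₁ : ℝ) ≠ 1 := by
    intro h1; apply hq₁; linarith
  have ha : 1 - q + q * (1 - q₁) ≠ 0 := by
    rw [show 1 - q + q * (1 - q₁) = 1 - q * q₁ by ring]; exact sub_ne_zero.2 (Ne.symm hqq)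
  rw [gate_lconv_split_at M₁ M₂ (gate A₁ q₁) (gate A₂ q₂) q (1 - q₁) g1M g2M hp ha h, coPart_const_gate A₁ q₁ hq₁,
    coPart_const_gate_gate A₂ q₁ q₂ hq₁]
  have e1 : 1 - q + q * (1 - q₁) = 1 - q * q₁ := by ring
  have e2 : (1 : ℝ) - (1 - q₁) = q₁ := by ring
  rw [e1, e2, show q₁ * (1 - q) = (1 - q) * q₁ by ring]

/-! ### DEC corollaries -/

/-- **DEC FROM A SPLIT AT LEVEL `p`**: if `0 ≤ p < 1`, `q ≤ 1`, `1 − q + qp > 0` (i.e. not `q = 1 ∧ p = 0`), and both the plain convolution of the gated factors and the gated convolution of the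
reduced factors are DEC at `(x, T, j, M₁+M₂)`, then so is `gate_q(μ₁ ∗ μ₂)` (`decAtT_mixture`; the weights `p/(1−q+qp)`, `(1−q)(1−p)/(1−q+qp)` are in
`[0,1]` and sum to `1`). [this work] -/
theorem decAtT_gate_lconv_of_split_at (x T : ℝ) (j M₁ M₂ : ℕ) (μ₁ μ₂ : ℕ → ℝ) (q p : ℝ)
    (h1M : ∀ h, M₁ < h → μ₁ h = 0) (h2M : ∀ h, M₂ < h → μ₂ h = 0)
    (hp0 : 0 ≤ p) (hp1 : p < 1) (hq1 : q ≤ 1) (ha : 0 < 1 - q + q * p)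
    (hS : DECAtT x T j (M₁ + M₂) (lconv M₁ M₂ (gate μ₁ q) (gate μ₂ q)))
    (hR : DECAtT x T j (M₁ + M₂) (gate (lconv M₁ M₂ (coPart (fun _ => p) μ₁) (coPart (fun _ => p) μ₂)) (q * (1 - p)))) :
    DECAtT x T j (M₁ + M₂) (gate (lconv M₁ M₂ μ₁ μ₂) q) := by
  have hw0 : 0 ≤ p / (1 - q + q * p) := div_nonneg hp0 ha.le
  have hw1 : p / (1 - q + q * p) ≤ 1 := by
    rw [div_le_one ha]; nlinarith
  have hmix := decAtT_mixture (p / (1 - q + q * p)) hw0 hw1 hS hR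
  have e : gate (lconv M₁ M₂ μ₁ μ₂) q = fun h => p / (1 - q + q * p) * lconv M₁ M₂ (gate μ₁ q) (gate μ₂ q) h +
      (1 - p / (1 - q + q * p)) * gate (lconv M₁ M₂ (coPart (fun _ => p) μ₁) (coPart (fun _ => p) μ₂)) (q * (1 - p)) h := by
    funext h
    rw [gate_lconv_split_at M₁ M₂ μ₁ μ₂ q p h1M h2M (ne_of_lt hp1) (ne_of_gt ha) h]
    have e1 : 1 - p / (1 - q + q * p) = (1 - q) * (1 - p) / (1 - q + q * p) := by
      rw [eq_div_iff (ne_of_gt ha), sub_mul, div_mul_cancel₀ _ (ne_of_gt ha)]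
      ring
    rw [e1]
  rw [e]
  exact hmix

/-- **DEC FROM THE TREE SURGERY**: `0 < q₁ ≤ 1`, `q ≤ 1`, `qq₁ < 1`; if the forest law `gate_q gate_{q₁}A₁ ∗ gate_q gate_{q₂}A₂` and the merged tree law
`gate_{qq₁}(A₁ ∗ gate_{q₂/q₁}A₂)` are DEC at `(x, T, j, M₁+M₂)`, then so is `gate_q(gate_{q₁}A₁ ∗ gate_{q₂}A₂)`. [this work] -/
theorem decAtT_gate_lconv_gate_gate (x T : ℝ) (j M₁ M₂ : ℕ) (A₁ A₂ : ℕ → ℝ) (q q₁ q₂ : ℝ)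
    (h1M : ∀ h, M₁ < h → A₁ h = 0) (h2M : ∀ h, M₂ < h → A₂ h = 0)
    (hq1 : q ≤ 1) (hq₁0 : 0 < q₁) (hq₁1 : q₁ ≤ 1) (hqq : q * q₁ < 1)
    (hS : DECAtT x T j (M₁ + M₂) (lconv M₁ M₂ (gate (gate A₁ q₁) q) (gate (gate A₂ q₂) q)))
    (hR : DECAtT x T j (M₁ + M₂) (gate (lconv M₁ M₂ A₁ (gate A₂ (q₂ / q₁))) (q * q₁))) :
    DECAtT x T j (M₁ + M₂) (gate (lconv M₁ M₂ (gate A₁ q₁) (gate A₂ q₂)) q) := by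
  have g1M : ∀ t, M₁ < t → gate A₁ q₁ t = 0 := fun t ht => by
    rw [gate_apply, h1M t ht, if_neg (by omega)]; ring
  have g2M : ∀ t, M₂ < t → gate A₂ q₂ t = 0 := fun t ht => by
    rw [gate_apply, h2M t ht, if_neg (by omega)]; ring
  have hR' : DECAtT x T j (M₁ + M₂)
      (gate (lconv M₁ M₂ (coPart (fun _ => 1 - q₁) (gate A₁ q₁)) (coPart (fun _ => 1 - q₁) (gate A₂ q₂))) (q * (1 - (1 - q₁)))) := by
    rw [coPart_const_gate A₁ q₁ (ne_of_gt hq₁0), coPart_const_gate_gate A₂ q₁ q₂ (ne_of_gt hq₁0), show (1 : ℝ) - (1 - q₁) = q₁ by ring]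
    exact hR
  exact decAtT_gate_lconv_of_split_at x T j M₁ M₂ (gate A₁ q₁) (gate A₂ q₂) q (1 - q₁) g1M g2M (by linarith) (by linarith) hq1
    (by nlinarith) hS hR'

end LawDec

end Quant

end Summit.CriticalPhenomena.PercolationContinuityZ3.Theorems
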